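import Mathlib.MeasureTheory.Order.Group.Lattice
import Literature.Probability.LatticeModels.GibbsSpecificationDLRProofs
import Literature.Probability.LatticeModels.DobrushinShlosmanWindowDusting
import HarnessLib

/-!
# Kernel and DLR lemmas for the coarse-cell mixing theorems

First companion ("theorems only") file of
`Literature/Probability/LatticeModels/CoarseCellFiniteSize.lean`: the model-independent
identities between the kernels `γ_Λ(· | ζ)` of a Georgii specification and its Gibbs measures that
every Dobrushin–Shlosman / van den Berg–Maes mixing estimate starts from (no cells yet):

* `gibbs_eq_kernel_univ` — on a FINITE site set a Gibbs measure is the full-volume kernel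
  `γ_V(· | ζ)` (the kernel is `𝓕_∅`-measurable in `ζ`, hence constant; DLR at `Λ = V`);
* `kernel_integral_mul_of_dependsOn` — properness: an observable blind to `Λ` factors out
  (the companion facts `γ_Λ(· | ζ)` only reads `ζ` off `Λ`, measurability and boundedness of
  `η ↦ γ_Λ f(η)` are `DobrushinShlosman.spec_apply_congr`, `….measurable_windowAvg'`,
  `….abs_windowAvg_le'` of `DobrushinShlosmanWindowDusting.lean`);
* `covariance_eq_integral_kernel`, `abs_covariance_le_integral_abs` — the DLR covariance identity
  `cov_ν(f,g) = ∫ g (γ_Λ f - ν f) dν` for `g` depending only on the spins off `Λ`, and the bound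
  `|cov_ν(f,g)| ≤ B_g ∫ |γ_Λ f - ν f| dν` (Georgii 2011, §8.2, averaged form of (8.29)–(8.31));
* `integral_abs_kernel_sub_rescale` — affine rescaling of `f` to `[0,1]` costs the factor `2 B_f`;
* `kernel_integral_integral_eq_of_subset` — consistency `γ_Λ γ_A = γ_Λ` for observables;
* `integral_kernel_real_eq` — DLR for kernel probabilities, `∫ γ_Λ(B | ζ) dν(ζ) = ν(B)`.

## References

* H.-O. Georgii, *Gibbs Measures and Phase Transitions*, 2nd ed. (de Gruyter 2011), Def. 1.23,
  Rem. 1.20, Rem. 1.24, §8.2.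
* S. Friedli, Y. Velenik, *Statistical Mechanics of Lattice Systems* (CUP 2017), Lemma 6.13,
  Exercise 6.6.
-/

noncomputable section

open _root_.MeasureTheory _root_.ProbabilityTheory
open scoped ENNReal

namespace Literature.Probability.LatticeModels

variable {V S : Type*} [MeasurableSpace S]

/-- **On a finite site set a Gibbs measure is the full-volume kernel.** For `V` finite the
kernel `ζ ↦ γ_V(A | ζ)` is measurable for the outside σ-algebra `𝓕_{Vᶜ} = 𝓕_∅ = ⊥`, hence
constant, and the DLR equation at `Λ = V` reads `ν(A) = γ_V(A | ζ) · ν(univ)`; in particular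
`𝒢(γ) = {γ_V(· | ζ)}` is a singleton. [cite: Georgii2011, Rem. 1.24] -/
theorem gibbs_eq_kernel_univ [Fintype V] {γ : Specification V S} (hγ : IsSpecification γ)
    {ν : Measure (V → S)} (hν : IsGibbsMeasure γ ν) (ζ : V → S) :
    ν = γ Finset.univ ζ := by
  haveI := hν.isProbabilityMeasure
  ext A hA
  have hconst : ∀ η, γ Finset.univ η A = γ Finset.univ ζ A := by
    intro η
    have hm := hγ.measurable Finset.univ A hA
    have hbot : cylinderEvents (X := fun _ : V => S) ((↑(Finset.univ : Finset V) : Set V)ᶜ) =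
        ⊥ := by
      rw [Finset.coe_univ, Set.compl_univ]
      simp [cylinderEvents]
    rw [hbot] at hm
    have hset : MeasurableSet[⊥]
        ((fun η : V → S => γ Finset.univ η A) ⁻¹' {γ Finset.univ ζ A}) :=
      hm (measurableSet_singleton _)
    rcases MeasurableSpace.measurableSet_bot_iff.1 hset with h | h
    · have hζ : ζ ∈ (fun η : V → S => γ Finset.univ η A) ⁻¹' {γ Finset.univ ζ A} := rfl
      rw [h] at hζ
      exact absurd hζ (Set.notMem_empty ζ)
    · have hη : η ∈ (fun η : V → S => γ Finset.univ η A) ⁻¹' {γ Finset.univ ζ A} := by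
        rw [h]; exact Set.mem_univ η
      simpa using hη
  have hdlr := hν.2 Finset.univ A hA
  simp_rw [hconst] at hdlr
  rw [lintegral_const, measure_univ, mul_one] at hdlr
  exact hdlr.symm

/-- **Properness, functional form**: an observable `g` depending only on the spins off `Λ`
factors out of the kernel, `γ_Λ(f g)(η) = g(η) γ_Λ f (η)`.
[cite: FriedliVelenik2017, Lemma 6.13] -/
theorem kernel_integral_mul_of_dependsOn {γ : Specification V S} (hγ : IsSpecification γ)
    (Λ : Finset V) {f g : (V → S) → ℝ} (hg : DependsOn g ((↑Λ : Set V)ᶜ)) (η : V → S) :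
    ∫ σ, f σ * g σ ∂(γ Λ η) = g η * ∫ σ, f σ ∂(γ Λ η) := by
  rw [← integral_const_mul]
  refine integral_congr_ae ?_
  filter_upwards [hγ.proper Λ η] with σ hσ
  rw [mul_comm, hg fun i hi => hσ i fun h => hi (Finset.mem_coe.2 h)]

/-- **DLR covariance identity**: for a Gibbs measure `ν` of the specification `γ`, bounded
measurable `f, g` with `g` blind to the spins in `Λ`,
`cov_ν(f,g) = ∫ g(ζ) (γ_Λ f (ζ) - ν f) dν(ζ)` — resample `Λ` under `ν` (DLR) and pull `g` out of
the kernel (properness). [cite: Georgii2011, §8.2] -/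
theorem covariance_eq_integral_kernel {γ : Specification V S} (hγ : IsSpecification γ)
    {ν : Measure (V → S)} (hν : IsGibbsMeasure γ ν) (Λ : Finset V) {f g : (V → S) → ℝ}
    (hf : Measurable f) (hg : Measurable g) {Bf Bg : ℝ} (hfB : ∀ σ, |f σ| ≤ Bf)
    (hgB : ∀ σ, |g σ| ≤ Bg) (hgdep : DependsOn g ((↑Λ : Set V)ᶜ)) :
    ∫ σ, f σ * g σ ∂ν - (∫ σ, f σ ∂ν) * ∫ σ, g σ ∂ν =
      ∫ ζ, g ζ * (∫ σ, f σ ∂(γ Λ ζ) - ∫ σ, f σ ∂ν) ∂ν := by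
  haveI := hν.isProbabilityMeasure
  have hKm : Measurable fun ζ => ∫ σ, f σ ∂(γ Λ ζ) := DobrushinShlosman.measurable_windowAvg' hγ Λ hf
  have hKb : ∀ ζ, |∫ σ, f σ ∂(γ Λ ζ)| ≤ Bf := DobrushinShlosman.abs_windowAvg_le' hγ Λ hfB
  have hBg : ∀ σ, 0 ≤ Bg := fun σ => (abs_nonneg _).trans (hgB σ)
  have hgi : Integrable g ν := DobrushinMetric.integrable_of_abs_le' hg hgB
  have hgKi : Integrable (fun ζ => g ζ * ∫ σ, f σ ∂(γ Λ ζ)) ν :=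
    DobrushinMetric.integrable_of_abs_le' (hg.mul hKm) (M := Bg * Bf) fun ζ => by
      rw [abs_mul]; exact mul_le_mul (hgB ζ) (hKb ζ) (abs_nonneg _) (hBg ζ)
  have hfgi : Integrable (fun σ => f σ * g σ) ν :=
    DobrushinMetric.integrable_of_abs_le' (hf.mul hg) (M := Bf * Bg) fun σ => by
      rw [abs_mul]
      exact mul_le_mul (hfB σ) (hgB σ) (abs_nonneg _) ((abs_nonneg _).trans (hfB σ))
  have hdlr : ∫ σ, f σ * g σ ∂ν = ∫ ζ, g ζ * ∫ σ, f σ ∂(γ Λ ζ) ∂ν := by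
    rw [← hν.integral_integral_eq hγ Λ hfgi]
    refine integral_congr_ae (ae_of_all _ fun ζ => ?_)
    exact kernel_integral_mul_of_dependsOn hγ Λ hgdep ζ
  rw [hdlr]
  simp_rw [mul_sub]
  rw [integral_sub hgKi (hgi.mul_const _), integral_mul_const, mul_comm (∫ σ, g σ ∂ν)]

/-- **Covariances are controlled by the averaged boundary influence**: under the hypotheses of
`covariance_eq_integral_kernel`, `|cov_ν(f,g)| ≤ B_g ∫ |γ_Λ f (ζ) - ν f| dν(ζ)`.
[cite: Georgii2011, §8.2] -/
theorem abs_covariance_le_integral_abs {γ : Specification V S} (hγ : IsSpecification γ)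
    {ν : Measure (V → S)} (hν : IsGibbsMeasure γ ν) (Λ : Finset V) {f g : (V → S) → ℝ}
    (hf : Measurable f) (hg : Measurable g) {Bf Bg : ℝ} (hfB : ∀ σ, |f σ| ≤ Bf)
    (hgB : ∀ σ, |g σ| ≤ Bg) (hgdep : DependsOn g ((↑Λ : Set V)ᶜ)) :
    |∫ σ, f σ * g σ ∂ν - (∫ σ, f σ ∂ν) * ∫ σ, g σ ∂ν| ≤
      Bg * ∫ ζ, |∫ σ, f σ ∂(γ Λ ζ) - ∫ σ, f σ ∂ν| ∂ν := by
  haveI := hν.isProbabilityMeasure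
  rw [covariance_eq_integral_kernel hγ hν Λ hf hg hfB hgB hgdep]
  have hKm : Measurable fun ζ => ∫ σ, f σ ∂(γ Λ ζ) := DobrushinShlosman.measurable_windowAvg' hγ Λ hf
  have hKb : ∀ ζ, |∫ σ, f σ ∂(γ Λ ζ)| ≤ Bf := DobrushinShlosman.abs_windowAvg_le' hγ Λ hfB
  have hDm : Measurable fun ζ => |∫ σ, f σ ∂(γ Λ ζ) - ∫ σ, f σ ∂ν| :=
    Measurable.abs (hKm.sub measurable_const)
  have hνf : |∫ σ, f σ ∂ν| ≤ Bf := by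
    have h := norm_integral_le_of_norm_le_const (μ := ν) (f := f) (C := Bf)
      (ae_of_all _ fun σ => by rw [Real.norm_eq_abs]; exact hfB σ)
    simpa using h
  have hDb : ∀ ζ, |(|∫ σ, f σ ∂(γ Λ ζ) - ∫ σ, f σ ∂ν|)| ≤ Bf + Bf := fun ζ => by
    rw [abs_abs]
    exact (abs_sub _ _).trans (add_le_add (hKb ζ) hνf)
  have hDi : Integrable (fun ζ => |∫ σ, f σ ∂(γ Λ ζ) - ∫ σ, f σ ∂ν|) ν :=
    DobrushinMetric.integrable_of_abs_le' hDm hDb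
  calc |∫ ζ, g ζ * (∫ σ, f σ ∂(γ Λ ζ) - ∫ σ, f σ ∂ν) ∂ν|
      ≤ ∫ ζ, |g ζ * (∫ σ, f σ ∂(γ Λ ζ) - ∫ σ, f σ ∂ν)| ∂ν := abs_integral_le_integral_abs
    _ ≤ ∫ ζ, Bg * |∫ σ, f σ ∂(γ Λ ζ) - ∫ σ, f σ ∂ν| ∂ν := by
        refine integral_mono_of_nonneg (ae_of_all _ fun ζ => abs_nonneg _)
          (hDi.const_mul Bg) (ae_of_all _ fun ζ => ?_)
        dsimp only
        rw [abs_mul]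
        exact mul_le_mul_of_nonneg_right (hgB ζ) (abs_nonneg _)
    _ = Bg * ∫ ζ, |∫ σ, f σ ∂(γ Λ ζ) - ∫ σ, f σ ∂ν| ∂ν := integral_const_mul _ _

/-- **Affine rescaling to `[0,1]`.** For `|f| ≤ B_f` with `B_f > 0` put
`f' := (f / B_f + 1) / 2 ∈ [0,1]`; then `γ_Λ f - ν f = 2 B_f (γ_Λ f' - ν f')` pointwise in the
boundary condition, so the averaged boundary influence of `f` is `2 B_f` times that of `f'`.
[folklore] -/
theorem integral_abs_kernel_sub_rescale {γ : Specification V S} (hγ : IsSpecification γ)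
    {ν : Measure (V → S)} [IsProbabilityMeasure ν] (Λ : Finset V) {f : (V → S) → ℝ}
    (hf : Measurable f) {Bf : ℝ} (hfB : ∀ σ, |f σ| ≤ Bf) (hBf : 0 < Bf) :
    ∫ ζ, |∫ σ, f σ ∂(γ Λ ζ) - ∫ σ, f σ ∂ν| ∂ν =
      2 * Bf * ∫ ζ, |∫ σ, (f σ / Bf + 1) / 2 ∂(γ Λ ζ) - ∫ σ, (f σ / Bf + 1) / 2 ∂ν| ∂ν := by
  have hfi : ∀ (μ : Measure (V → S)) [IsProbabilityMeasure μ], Integrable f μ :=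
    fun μ _ => DobrushinMetric.integrable_of_abs_le' hf hfB
  have hresc : ∀ (μ : Measure (V → S)) [IsProbabilityMeasure μ],
      ∫ σ, (f σ / Bf + 1) / 2 ∂μ = ((∫ σ, f σ ∂μ) / Bf + 1) / 2 := by
    intro μ _
    have h1 : ∫ σ, (f σ / Bf + 1) / 2 ∂μ = (∫ σ, (f σ / Bf + 1) ∂μ) / 2 :=
      integral_div 2 _
    have h2 : ∫ σ, (f σ / Bf + 1) ∂μ = (∫ σ, f σ / Bf ∂μ) + 1 := by
      rw [integral_add ((hfi μ).div_const Bf) (integrable_const 1)]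
      simp
    have h3 : ∫ σ, f σ / Bf ∂μ = (∫ σ, f σ ∂μ) / Bf := integral_div Bf _
    rw [h1, h2, h3]
  have hpt : ∀ ζ, |∫ σ, f σ ∂(γ Λ ζ) - ∫ σ, f σ ∂ν| =
      2 * Bf * |∫ σ, (f σ / Bf + 1) / 2 ∂(γ Λ ζ) - ∫ σ, (f σ / Bf + 1) / 2 ∂ν| := by
    intro ζ
    haveI := hγ.isProbability Λ ζ
    rw [hresc (γ Λ ζ), hresc ν]
    have h2Bf : 0 ≤ 2 * Bf := by positivity
    rw [← abs_of_nonneg h2Bf, ← abs_mul]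
    congr 1
    field_simp
    ring
  simp_rw [hpt]
  exact integral_const_mul _ _

/-- **Consistency, functional form** (`γ_Λ γ_A = γ_Λ` for `A ⊆ Λ`, integrated against a bounded
measurable observable; the DLR resampling step INSIDE a kernel):
`∫ (γ_A f)(σ) dγ_Λ(σ | ζ) = γ_Λ f (ζ)` (Mathlib `Kernel.integral_comp`).
[cite: Georgii2011, Def. 1.23] -/
theorem kernel_integral_integral_eq_of_subset {γ : Specification V S} (hγ : IsSpecification γ)
    {A Λ : Finset V} (hAΛ : A ⊆ Λ) (ζ : V → S) {f : (V → S) → ℝ} (hf : Measurable f) {M : ℝ}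
    (hM : ∀ σ, |f σ| ≤ M) :
    ∫ σ, ∫ τ, f τ ∂(γ A σ) ∂(γ Λ ζ) = ∫ σ, f σ ∂(γ Λ ζ) := by
  let κ : Kernel (V → S) (V → S) := ⟨γ A, hγ.measurable_fun A⟩
  haveI := hγ.isProbability Λ ζ
  have hbind : (γ Λ ζ).bind (γ A) = γ Λ ζ := by
    ext B hB
    rw [Measure.bind_apply hB (hγ.measurable_fun A).aemeasurable]
    exact hγ.consistent hAΛ ζ B hB
  have hcomp : (κ ∘ₖ Kernel.const Unit (γ Λ ζ)) () = γ Λ ζ := by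
    rw [Kernel.comp_apply, Kernel.const_apply]
    exact hbind
  have hfi : Integrable f ((κ ∘ₖ Kernel.const Unit (γ Λ ζ)) ()) := by
    rw [hcomp]; exact DobrushinMetric.integrable_of_abs_le' hf hM
  have key := Kernel.integral_comp hfi
  rw [hcomp, Kernel.const_apply] at key
  exact key.symm

/-- The expectation of a `[0,1]`-valued measurable observable under a probability measure lies
in `[0,1]`. [folklore] -/
theorem integral_mem_unitInterval {μ : Measure (V → S)} [IsProbabilityMeasure μ]
    {f : (V → S) → ℝ} (hf : Measurable f) (hf01 : ∀ σ, 0 ≤ f σ ∧ f σ ≤ 1) :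
    0 ≤ ∫ σ, f σ ∂μ ∧ ∫ σ, f σ ∂μ ≤ 1 := by
  refine ⟨integral_nonneg fun σ => (hf01 σ).1, ?_⟩
  have hfi : Integrable f μ := DobrushinMetric.integrable_of_abs_le' hf (M := 1) fun σ => by
    rw [abs_of_nonneg (hf01 σ).1]; exact (hf01 σ).2
  calc ∫ σ, f σ ∂μ ≤ ∫ _σ, (1 : ℝ) ∂μ := integral_mono hfi (integrable_const 1) fun σ => (hf01 σ).2
    _ = 1 := by simp

/-- **DLR for kernel probabilities, real form**: `∫ γ_Λ(B | ζ) dν(ζ) = ν(B)` for a Gibbs measure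
`ν`. [cite: Georgii2011, Rem. 1.24] -/
theorem integral_kernel_real_eq {γ : Specification V S} (hγ : IsSpecification γ)
    {ν : Measure (V → S)} (hν : IsGibbsMeasure γ ν) (Λ : Finset V) {B : Set (V → S)}
    (hB : MeasurableSet B) : ∫ ζ, (γ Λ ζ).real B ∂ν = ν.real B := by
  have hmeas : Measurable fun η => γ Λ η B := hγ.measurable_coe Λ hB
  have hlt : ∀ η, γ Λ η B < ∞ := fun η => by
    haveI := hγ.isProbability Λ η
    exact measure_lt_top _ _
  simp_rw [measureReal_def]
  rw [integral_toReal hmeas.aemeasurable (ae_of_all _ hlt), hν.2 Λ B hB]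

end Literature.Probability.LatticeModels
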